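import Literature.MathematicalPhysics.QuantumManyBody.LHYIntegrandBounds
import Literature.MathematicalPhysics.QuantumManyBody.LHYLatticeSums
import Literature.MathematicalPhysics.QuantumManyBody.LeeHuangYangIntegral
import Mathlib.Analysis.Calculus.MeanValue
import Mathlib.Analysis.InnerProductSpace.Calculus
import Mathlib.Analysis.Real.Pi.Bounds
import HarnessLib

/-!
# The LHY Riemann sum on the Neumann lattice (FGJMOT Lemma 8.1: "one easily checks")

Topic `Literature/MathematicalPhysics/QuantumManyBody`, namespace `BoseGas` (provefact
`Literature.MathematicalPhysics.QuantumManyBody.BoseGas.Junge2026_neumannBox_pinnedLowerBound`;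
third and last file of the Riemann-sum step of [FournaisEtAl2024, Lemma 8.1], on top of
`LHYIntegrandBounds.lean` (size and smoothness of the radial profile
`f(r) = √(r⁴+2r²) - r² - 1 + 1/(2r²) = r²G(r⁻²)`) and `LHYLatticeSums.lean` (shell sums on `ℕ₀³`)).
In the proof of [FournaisEtAl2024, Lemma 8.1] the Bogoliubov mode sum over the Neumann momenta
`Λ*₊ = (π/ℓ)ℕ₀³ ∖ 0` is compared with the Lee–Huang–Yang integral:
"recalling that `Λ* = πℓ⁻¹ℕ₀³`, one easily checks that
`|(π³/ℓ³)∑_{p ∈ Λ*₊} p²G(8πρ_z a/p²) - 8∫_{ℝ₊³} p²G(8πρ_z a/p²)dp| ≤ …`", after which the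
integral is evaluated (`integral_bogoliubov`, `lhy_correction_integral` of
`LeeHuangYangIntegral.lean`: the constant `128/(15√π)`). By the scaling `p²G(λ/p²) = λ f(|p|/√λ)`
this is a statement about the Riemann sum of `q ↦ f(|q|)` on the octant lattice `hℕ₀³`,
`h = π/(ℓ√λ)`, which is what this file proves, with an explicit rate:

* `abs_lhyRiemannSum_sub_integral_le` — for `0 < h ≤ ½`,
  `|h³ ∑_{k ∈ ℕ₀³, k ≠ 0} f(h|k|) - ∫_{ℝ₊³} f(|q|) dq| ≤ 270 h (1 + |log h|)`, and the lattice sum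
  is summable;
* `abs_lhyRiemannSum_sub_integral_le_scaled` — the same for the integrand
  `F_λ(p) = √(p⁴+2λp²) - p² - λ + λ²/(2p²) = λf(|p|/√λ)` of `integral_bogoliubov` (`λ = 8πρ_z a`):
  `|h³∑_{k≠0} F_λ(h|k|) - ∫_{ℝ₊³} F_λ| ≤ 270 λ² h (1 + |log(h/√λ)|)` for `0 < h ≤ √λ/2`
  (`bogoliubovIntegrand_eq_mul_profile`, dilation of the octant).

Architecture (the printed "one easily checks", made honest): the half-open cells
`C_k = h(k + [0,1)³)` tile the closed octant (`iUnion_latticeCell`, `pairwise_disjoint_latticeCell`,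
volume `h³`), so `∫_{ℝ₊³} = ∑_k ∫_{C_k}` (`hasSum_integral_iUnion`); on `C_k`, `k ≠ 0`, the mean
value theorem along the segment from the corner `hk` (which stays at distance `≥ h|k|` from the
origin; `d/dt f(‖γ(t)‖) = f'(‖γ‖)⟪γ, γ'⟫/‖γ‖`) gives
`|h³f(h|k|) - ∫_{C_k} f| ≤ h³ · √3h · sup|f'|` (`abs_riemannTerm_sub_setIntegral_le`), with
`sup|f'| ≤ 6(h|k|∞)⁻³` always and `≤ 3(h|k|∞)⁻⁵` when `h|k|∞ ≥ 1` (`|k|∞ ≤ |k|₂`); the shell sums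
`∑_{1 ≤ |k|∞ < ⌈1/h⌉} |k|∞⁻³ ≤ 12(1 + |log h|)`, `∑_{|k|∞ ≥ ⌈1/h⌉} |k|∞⁻⁵ ≤ 24h²` then give
`72√3 h(1 + |log h|) + 72√3 h`; the origin cell contributes `0 ≤ ∫_{[0,h)³} f ≤ ∫_{B(0,2h)} f ≤ 4πh`
(polar coordinates, `r²f(r) ≤ ½`). Constants: `4π + 144√3 < 270`.

No definitions (the profile and its derivative are local notations).

## References

* [FournaisEtAl2024] S. Fournais, L. Junge, T. Girardot, L. Morin, M. Olivieri, A. Triay, *The free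
  energy of dilute Bose gases at low temperatures interacting via strong potentials*,
  arXiv:2408.14222, Ann. Henri Poincaré (2026): Lemma 8.1 and its proof (the Riemann-sum display).
-/

noncomputable section

open Real MeasureTheory Set Filter Topology
open scoped InnerProductSpace Pointwise

namespace Literature.MathematicalPhysics.QuantumManyBody.BoseGas

/-- The radial profile `f(r) = √(r⁴+2r²) - r² - 1 + 1/(2r²)` (local notation). -/
local notation "𝔣" => fun r : ℝ => Real.sqrt (r ^ 4 + 2 * r ^ 2) - r ^ 2 - 1 + 1 / (2 * r ^ 2)

/-- Its derivative `f'(r) = 2(r²+1)/√(r²+2) - 2r - r⁻³` (local notation). -/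
local notation "𝔣'" => fun r : ℝ => 2 * (r ^ 2 + 1) / Real.sqrt (r ^ 2 + 2) - 2 * r - (r ^ 3)⁻¹

/-! ### A. The integrand `F(q) = f(‖q‖)` on `ℝ³` -/

/-- **`|f'(r)| ≤ 6/r³` for all `r > 0`** (the two regimes of `LHYIntegrandBounds`).
[cite: FournaisEtAl2024, Lemma 8.1 (proof)] -/
theorem abs_bogoliubovProfile_deriv_le {r : ℝ} (hr : 0 < r) : |𝔣' r| ≤ 6 / r ^ 3 := by
  rcases le_or_gt r 1 with h | h
  · exact abs_bogoliubovProfile_deriv_le_of_le_one hr h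
  · refine (abs_bogoliubovProfile_deriv_le_of_one_le h.le).trans ?_
    rw [div_le_div_iff₀ (by positivity) (by positivity)]
    nlinarith [pow_le_pow_left₀ zero_le_one h.le 2, pow_pos hr 3]

/-- Componentwise `0 ≤ a ≤ b` implies `‖a‖ ≤ ‖b‖`. [folklore] -/
theorem norm_le_norm_of_forall_le {a b : Space} (h0 : ∀ i, 0 ≤ a i) (hab : ∀ i, a i ≤ b i) :
    ‖a‖ ≤ ‖b‖ := by
  rw [EuclideanSpace.norm_eq, EuclideanSpace.norm_eq]
  refine Real.sqrt_le_sqrt (Finset.sum_le_sum fun i _ => ?_)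
  rw [Real.norm_eq_abs, Real.norm_eq_abs, abs_of_nonneg (h0 i), abs_of_nonneg ((h0 i).trans (hab i))]
  exact pow_le_pow_left₀ (h0 i) (hab i) 2

/-- `‖d‖ ≤ √3 h` if every coordinate of `d` lies in `[0, h]`. [folklore] -/
theorem norm_le_sqrt_three_mul {d : Space} {h : ℝ} (hd : ∀ i, 0 ≤ d i ∧ d i ≤ h) :
    ‖d‖ ≤ Real.sqrt 3 * h := by
  have hh : 0 ≤ h := (hd 0).1.trans (hd 0).2
  rw [EuclideanSpace.norm_eq, show Real.sqrt 3 * h = Real.sqrt (3 * h ^ 2) by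
    rw [Real.sqrt_mul (by norm_num), Real.sqrt_sq hh]]
  refine Real.sqrt_le_sqrt ?_
  calc ∑ i, ‖d i‖ ^ 2 ≤ ∑ _i : Fin 3, h ^ 2 := Finset.sum_le_sum fun i _ => by
          rw [Real.norm_eq_abs, abs_of_nonneg (hd i).1]
          exact pow_le_pow_left₀ (hd i).1 (hd i).2 2
    _ = 3 * h ^ 2 := by simp

/-- **Mean value along a cell**: let `q₀ ≠ 0` have non-negative coordinates, `q ≥ q₀`
componentwise, and `|f'(r)| ≤ M` for all `r ≥ ‖q₀‖`. Then `|f(‖q‖) - f(‖q₀‖)| ≤ M‖q - q₀‖`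
(the segment `t ↦ q₀ + t(q - q₀)` stays at distance `≥ ‖q₀‖` from the origin; chain rule with
`d/dt ‖γ(t)‖ = ⟪γ, q - q₀⟫/‖γ‖`, `|·| ≤ ‖q - q₀‖`). [cite: FournaisEtAl2024, Lemma 8.1 (proof)] -/
theorem abs_sub_le_of_deriv_bound {q₀ q : Space} (hq₀ : q₀ ≠ 0) (h0 : ∀ i, 0 ≤ q₀ i)
    (hle : ∀ i, q₀ i ≤ q i) {M : ℝ} (hM : ∀ r, ‖q₀‖ ≤ r → |𝔣' r| ≤ M) :
    |𝔣 ‖q‖ - 𝔣 ‖q₀‖| ≤ M * ‖q - q₀‖ := by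
  set d : Space := q - q₀ with hd
  set γ : ℝ → Space := fun t => q₀ + t • d with hγ
  have hnorm_pos : 0 < ‖q₀‖ := norm_pos_iff.2 hq₀
  have hM0 : 0 ≤ M := (abs_nonneg _).trans (hM ‖q₀‖ le_rfl)
  -- on `[0,1]` the segment dominates `q₀` componentwise
  have hγge : ∀ t ∈ Icc (0 : ℝ) 1, ‖q₀‖ ≤ ‖γ t‖ := by
    intro t ht
    refine norm_le_norm_of_forall_le h0 fun i => ?_
    simp only [hγ, hd, PiLp.add_apply, PiLp.smul_apply, PiLp.sub_apply, smul_eq_mul]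
    nlinarith [ht.1, hle i]
  -- derivative of `t ↦ ‖γ t‖`
  have hγd : ∀ t, HasDerivAt γ d t := fun t => by
    have := ((hasDerivAt_id t).smul_const d).const_add q₀
    simpa [hγ] using this
  have hn : ∀ t ∈ Icc (0 : ℝ) 1, HasDerivAt (fun s => ‖γ s‖) (⟪γ t, d⟫_ℝ / ‖γ t‖) t := by
    intro t ht
    have hpos : 0 < ‖γ t‖ := hnorm_pos.trans_le (hγge t ht)
    have h1 : HasDerivAt (fun s => ‖γ s‖ ^ 2) (2 * ⟪γ t, d⟫_ℝ) t := (hγd t).norm_sq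
    have h2 := h1.sqrt (by positivity : ‖γ t‖ ^ 2 ≠ 0)
    have h3 : (fun s => Real.sqrt (‖γ s‖ ^ 2)) = fun s => ‖γ s‖ := by
      funext s; exact Real.sqrt_sq (norm_nonneg _)
    rw [h3, Real.sqrt_sq hpos.le] at h2
    convert h2 using 1
    field_simp
  -- chain rule
  have hφ : ∀ t ∈ Icc (0 : ℝ) 1,
      HasDerivAt (fun s => 𝔣 ‖γ s‖) (𝔣' ‖γ t‖ * (⟪γ t, d⟫_ℝ / ‖γ t‖)) t := by
    intro t ht
    have hpos : 0 < ‖γ t‖ := hnorm_pos.trans_le (hγge t ht)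
    exact (hasDerivAt_bogoliubovProfile hpos).comp t (hn t ht)
  -- the bound on the derivative
  have hbound : ∀ t ∈ Ico (0 : ℝ) 1, ‖𝔣' ‖γ t‖ * (⟪γ t, d⟫_ℝ / ‖γ t‖)‖ ≤ M * ‖d‖ := by
    intro t ht
    have ht' : t ∈ Icc (0 : ℝ) 1 := Ico_subset_Icc_self ht
    have hpos : 0 < ‖γ t‖ := hnorm_pos.trans_le (hγge t ht')
    rw [Real.norm_eq_abs, abs_mul, abs_div, abs_norm]
    refine mul_le_mul (hM _ (hγge t ht')) ?_ (by positivity) hM0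
    rw [div_le_iff₀ hpos]
    calc |⟪γ t, d⟫_ℝ| ≤ ‖γ t‖ * ‖d‖ := abs_real_inner_le_norm _ _
      _ = ‖d‖ * ‖γ t‖ := mul_comm _ _
  have key := norm_image_sub_le_of_norm_deriv_le_segment_01'
    (f := fun s => 𝔣 ‖γ s‖) (fun t ht => (hφ t ht).hasDerivWithinAt) hbound
  have hγ1 : γ 1 = q := by simp [hγ, hd]
  have hγ0 : γ 0 = q₀ := by simp [hγ]
  simp only [hγ1, hγ0, Real.norm_eq_abs] at key
  exact key

/-- **The integrand `F(q) = f(‖q‖)` is integrable on `ℝ³`** (`μ = 1` in `integrable_bogoliubov`).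
[cite: FournaisEtAl2024, Lemma 8.1 (proof)] -/
theorem integrable_bogoliubovProfile_norm : Integrable (fun q : Space => 𝔣 ‖q‖) := by
  refine (integrable_bogoliubov one_pos).congr (ae_of_all _ fun q => ?_)
  simp only [mul_one, one_pow]

/-- `F ≥ 0` away from the origin. [cite: FournaisEtAl2024, Lemma 8.1 (proof)] -/
theorem bogoliubovProfile_norm_nonneg {q : Space} (hq : q ≠ 0) : 0 ≤ 𝔣 ‖q‖ :=
  bogoliubovProfile_nonneg (norm_pos_iff.2 hq)

/-- `F ≥ 0` almost everywhere. [folklore] -/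
theorem bogoliubovProfile_norm_nonneg_ae :
    0 ≤ᵐ[volume] fun q : Space => 𝔣 ‖q‖ := by
  have h0 : volume ({0} : Set Space) = 0 := measure_singleton 0
  filter_upwards [measure_eq_zero_iff_ae_notMem.1 h0] with q hq
  exact bogoliubovProfile_norm_nonneg hq

/-! ### B. The lattice points `h k` and the cells `C_k = h(k + [0,1)³)` -/

/-- Coordinates of the lattice point. [folklore] -/
theorem latticePoint_apply (k : Fin 3 → ℕ) (i : Fin 3) :
    (WithLp.toLp 2 (fun i => (k i : ℝ)) : Space) i = k i := by
  simp

/-- `kᵢ ≤ |k|₂`. [folklore] -/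
theorem natCast_le_norm_latticePoint (k : Fin 3 → ℕ) (i : Fin 3) :
    (k i : ℝ) ≤ ‖(WithLp.toLp 2 (fun i => (k i : ℝ)) : Space)‖ := by
  have h := PiLp.norm_apply_le (WithLp.toLp 2 (fun i => (k i : ℝ)) : Space) i
  rwa [Real.norm_eq_abs, latticePoint_apply, Nat.abs_cast] at h

/-- **`|k|∞ ≤ |k|₂`.** [folklore] -/
theorem sup_le_norm_latticePoint (k : Fin 3 → ℕ) :
    ((Finset.univ.sup k : ℕ) : ℝ) ≤ ‖(WithLp.toLp 2 (fun i => (k i : ℝ)) : Space)‖ := by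
  obtain ⟨i, _, hi⟩ := Finset.exists_mem_eq_sup (Finset.univ : Finset (Fin 3)) Finset.univ_nonempty k
  rw [hi]
  exact natCast_le_norm_latticePoint k i

/-- A non-zero multi-index gives a non-zero lattice point. [folklore] -/
theorem latticePoint_ne_zero {k : Fin 3 → ℕ} (hk : k ≠ 0) :
    (WithLp.toLp 2 (fun i => (k i : ℝ)) : Space) ≠ 0 := by
  obtain ⟨i, hi⟩ : ∃ i, k i ≠ 0 := Function.ne_iff.1 hk
  intro h
  have := congrArg (fun q : Space => q i) h
  simp [hi] at this

/-- For `k ≠ 0`, `|k|∞ ≥ 1`. [folklore] -/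
theorem one_le_sup_of_ne_zero {k : Fin 3 → ℕ} (hk : k ≠ 0) : 1 ≤ Finset.univ.sup k := by
  obtain ⟨i, hi⟩ : ∃ i, k i ≠ 0 := Function.ne_iff.1 hk
  exact le_trans (Nat.one_le_iff_ne_zero.2 hi) (Finset.le_sup (Finset.mem_univ i))

/-- The cell is measurable. [folklore] -/
theorem measurableSet_latticeCell (h : ℝ) (k : Fin 3 → ℕ) :
    MeasurableSet {q : Space | ∀ i, h * k i ≤ q i ∧ q i < h * (k i + 1)} := by
  have : {q : Space | ∀ i, h * k i ≤ q i ∧ q i < h * (k i + 1)} =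
      ⋂ i, (fun q : Space => q i) ⁻¹' Ico (h * k i) (h * (k i + 1)) := by
    ext q; simp [Set.mem_iInter]
  rw [this]
  exact MeasurableSet.iInter fun i =>
    measurableSet_Ico.preimage (by fun_prop : Measurable fun q : Space => q i)

/-- The cell is the translate by its corner `h k` of the fundamental cell `[0,h)³`. [folklore] -/
theorem latticeCell_eq_preimage (h : ℝ) (k : Fin 3 → ℕ) :
    {q : Space | ∀ i, h * k i ≤ q i ∧ q i < h * (k i + 1)} =
      (fun q : Space => q + -(h • (WithLp.toLp 2 (fun i => (k i : ℝ)) : Space))) ⁻¹' cell h := by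
  ext q
  simp only [Set.mem_setOf_eq, Set.mem_preimage, cell, Set.mem_Ico, PiLp.add_apply, PiLp.neg_apply,
    PiLp.smul_apply, smul_eq_mul]
  refine forall_congr' fun i => ?_
  constructor <;> rintro ⟨h1, h2⟩ <;> constructor <;> linarith

/-- **The cell has volume `h³`.** [folklore] -/
theorem volume_latticeCell {h : ℝ} (k : Fin 3 → ℕ) :
    volume {q : Space | ∀ i, h * k i ≤ q i ∧ q i < h * (k i + 1)} = ENNReal.ofReal h ^ 3 := by
  rw [latticeCell_eq_preimage, measure_preimage_add_right, volume_cell]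

/-- Real form of the volume (`h ≥ 0`). [folklore] -/
theorem volume_real_latticeCell {h : ℝ} (hh : 0 ≤ h) (k : Fin 3 → ℕ) :
    volume.real {q : Space | ∀ i, h * k i ≤ q i ∧ q i < h * (k i + 1)} = h ^ 3 := by
  rw [measureReal_def, volume_latticeCell, ← ENNReal.ofReal_pow hh, ENNReal.toReal_ofReal (by positivity)]

/-- Membership in a cell is given by the floors of the coordinates (`h > 0`, `q ≥ 0`). [folklore] -/
theorem mem_latticeCell_iff_floor {h : ℝ} (hh : 0 < h) {q : Space} (hq : ∀ i, 0 ≤ q i)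
    (k : Fin 3 → ℕ) :
    (∀ i, h * k i ≤ q i ∧ q i < h * (k i + 1)) ↔ ∀ i, k i = ⌊q i / h⌋₊ := by
  refine forall_congr' fun i => ?_
  rw [eq_comm, Nat.floor_eq_iff (div_nonneg (hq i) hh.le), le_div_iff₀ hh, div_lt_iff₀ hh]
  constructor <;> rintro ⟨h1, h2⟩ <;> constructor <;> linarith

/-- **The cells are pairwise disjoint** (`h > 0`). [folklore] -/
theorem pairwise_disjoint_latticeCell {h : ℝ} (hh : 0 < h) :
    Pairwise (Function.onFun Disjoint fun k : Fin 3 → ℕ =>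
      {q : Space | ∀ i, h * k i ≤ q i ∧ q i < h * (k i + 1)}) := by
  intro k k' hkk'
  rw [Function.onFun, Set.disjoint_left]
  intro q hq hq'
  apply hkk'
  have hq0 : ∀ i, 0 ≤ q i := fun i => le_trans (by positivity) (hq i).1
  funext i
  rw [(mem_latticeCell_iff_floor hh hq0 k).1 hq i, (mem_latticeCell_iff_floor hh hq0 k').1 hq' i]

/-- **The cells tile the closed positive octant** (`h > 0`). [folklore] -/
theorem iUnion_latticeCell {h : ℝ} (hh : 0 < h) :
    (⋃ k : Fin 3 → ℕ, {q : Space | ∀ i, h * k i ≤ q i ∧ q i < h * (k i + 1)}) =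
      {q : Space | ∀ i, 0 ≤ q i} := by
  ext q
  simp only [Set.mem_iUnion, Set.mem_setOf_eq]
  constructor
  · rintro ⟨k, hk⟩ i
    exact le_trans (by positivity) (hk i).1
  · intro hq
    exact ⟨fun i => ⌊q i / h⌋₊, (mem_latticeCell_iff_floor hh hq _).2 fun i => rfl⟩

/-- A point of the cell exceeds the corner by at most `h` in every coordinate. [folklore] -/
theorem sub_corner_mem {h : ℝ} {k : Fin 3 → ℕ} {q : Space}
    (hq : ∀ i, h * k i ≤ q i ∧ q i < h * (k i + 1)) (i : Fin 3) :
    0 ≤ (q - h • (WithLp.toLp 2 (fun i => (k i : ℝ)) : Space)) i ∧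
      (q - h • (WithLp.toLp 2 (fun i => (k i : ℝ)) : Space)) i ≤ h := by
  simp only [PiLp.sub_apply, PiLp.smul_apply, smul_eq_mul]
  constructor <;> nlinarith [(hq i).1, (hq i).2]

/-! ### C. The error on one cell -/

/-- **The error of the Riemann sum on the cell at `k ≠ 0`**: if `|f'(r)| ≤ M` for all
`r ≥ h|k|₂`, then `|h³ f(h|k|₂) - ∫_{C_k} f(‖q‖)dq| ≤ h³ · M · √3 h` (mean value along the cell,
`diam C_k = √3 h`, `vol C_k = h³`). [cite: FournaisEtAl2024, Lemma 8.1 (proof)] -/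
theorem abs_riemannTerm_sub_setIntegral_le {h : ℝ} (hh : 0 < h) {k : Fin 3 → ℕ} (hk : k ≠ 0)
    {M : ℝ} (hM : ∀ r, h * ‖(WithLp.toLp 2 (fun i => (k i : ℝ)) : Space)‖ ≤ r → |𝔣' r| ≤ M) :
    |h ^ 3 * 𝔣 (h * ‖(WithLp.toLp 2 (fun i => (k i : ℝ)) : Space)‖) -
        ∫ q in {q : Space | ∀ i, h * k i ≤ q i ∧ q i < h * (k i + 1)}, 𝔣 ‖q‖| ≤
      h ^ 3 * (M * (Real.sqrt 3 * h)) := by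
  set v : Space := WithLp.toLp 2 (fun i => (k i : ℝ)) with hv
  set q₀ : Space := h • v with hq₀
  set C : Set Space := {q : Space | ∀ i, h * k i ≤ q i ∧ q i < h * (k i + 1)} with hC
  have hq₀norm : ‖q₀‖ = h * ‖v‖ := by rw [hq₀, norm_smul, Real.norm_eq_abs, abs_of_pos hh]
  have hq₀ne : q₀ ≠ 0 := by
    rw [hq₀]; exact smul_ne_zero hh.ne' (latticePoint_ne_zero hk)
  have hq₀nn : ∀ i, 0 ≤ q₀ i := fun i => by
    simp only [hq₀, hv, PiLp.smul_apply, smul_eq_mul]; positivity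
  have hM0 : 0 ≤ M := (abs_nonneg _).trans (hM _ le_rfl)
  have hvolC : volume C < ⊤ := by rw [hC, volume_latticeCell]; exact ENNReal.pow_lt_top ENNReal.ofReal_lt_top
  have hint : IntegrableOn (fun q : Space => 𝔣 ‖q‖) C := integrable_bogoliubovProfile_norm.integrableOn
  have hconst : ∫ _q in C, 𝔣 ‖q₀‖ = h ^ 3 * 𝔣 ‖q₀‖ := by
    rw [setIntegral_const, hC, volume_real_latticeCell hh.le, smul_eq_mul]
  have hcint : Integrable (fun _ : Space => 𝔣 ‖q₀‖) (volume.restrict C) :=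
    integrableOn_const (C := 𝔣 ‖q₀‖) hvolC.ne
  rw [← hq₀norm, ← hconst, ← integral_sub hcint hint]
  have hbd : ∀ q ∈ C, ‖𝔣 ‖q₀‖ - 𝔣 ‖q‖‖ ≤ M * (Real.sqrt 3 * h) := by
    intro q hq
    rw [Real.norm_eq_abs, abs_sub_comm]
    have hle : ∀ i, q₀ i ≤ q i := fun i => by
      have := (sub_corner_mem hq i).1
      simp only [PiLp.sub_apply] at this
      linarith
    have hM' : ∀ r, ‖q₀‖ ≤ r → |𝔣' r| ≤ M := by rw [hq₀norm]; exact hM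
    refine (abs_sub_le_of_deriv_bound hq₀ne hq₀nn hle hM').trans ?_
    exact mul_le_mul_of_nonneg_left (norm_le_sqrt_three_mul (sub_corner_mem hq)) hM0
  calc |∫ q in C, (𝔣 ‖q₀‖ - 𝔣 ‖q‖)| = ‖∫ q in C, (𝔣 ‖q₀‖ - 𝔣 ‖q‖)‖ := (Real.norm_eq_abs _).symm
    _ ≤ M * (Real.sqrt 3 * h) * volume.real C := norm_setIntegral_le_of_norm_le_const hvolC hbd
    _ = h ^ 3 * (M * (Real.sqrt 3 * h)) := by rw [hC, volume_real_latticeCell hh.le]; ring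

/-! ### D. The origin cell -/

/-- **The ball integral in polar coordinates**: `∫_{|q| < R} f(‖q‖)dq ≤ 2πR`, since
`r²f(r) ≤ ½`. [cite: FournaisEtAl2024, Lemma 8.1 (proof)] -/
theorem setIntegral_ball_bogoliubovProfile_norm_le {R : ℝ} (hR : 0 ≤ R) :
    ∫ q in Metric.ball (0 : Space) R, 𝔣 ‖q‖ ≤ 2 * π * R := by
  set g : ℝ → ℝ := fun r => if r < R then 𝔣 r else 0 with hg
  have hind : ∀ q : Space, (Metric.ball (0 : Space) R).indicator (fun q : Space => 𝔣 ‖q‖) q = g ‖q‖ := by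
    intro q
    by_cases hq : ‖q‖ < R
    · rw [Set.indicator_of_mem (mem_ball_zero_iff.2 hq)]; simp [hg, hq]
    · rw [Set.indicator_of_notMem (fun h => hq (mem_ball_zero_iff.1 h))]; simp [hg, hq]
  rw [← integral_indicator Metric.isOpen_ball.measurableSet]
  simp_rw [hind]
  rw [integral_fun_norm_addHaar (volume : Measure Space) g, finrank_euclideanSpace_fin]
  simp only [Nat.add_one_sub_one, smul_eq_mul, nsmul_eq_mul, Nat.cast_ofNat]
  -- the radial integral is at most `R/2`
  have hrad : ∫ y in Ioi (0 : ℝ), y ^ 2 * g y ≤ R / 2 := by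
    have hle : ∀ y ∈ Ioi (0 : ℝ), y ^ 2 * g y ≤ (Ioo (0 : ℝ) R).indicator (fun _ => (1 / 2 : ℝ)) y := by
      intro y hy
      by_cases hyR : y < R
      · have hmem : y ∈ Ioo (0 : ℝ) R := ⟨hy, hyR⟩
        rw [Set.indicator_of_mem hmem]
        simp only [hg, hyR, if_true]
        have h1 := bogoliubovProfile_le_inv_sq hy
        have hy0 : (0 : ℝ) < y := hy
        have hy0' : y ≠ 0 := hy0.ne'
        have hy2 : 0 < y ^ 2 := by positivity
        calc y ^ 2 * 𝔣 y ≤ y ^ 2 * (1 / (2 * y ^ 2)) := by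
              exact mul_le_mul_of_nonneg_left h1 hy2.le
          _ = 1 / 2 := by field_simp
      · rw [Set.indicator_of_notMem (fun h => hyR h.2)]
        simp [hg, hyR]
    have hnn : ∀ y ∈ Ioi (0 : ℝ), 0 ≤ y ^ 2 * g y := by
      intro y hy
      by_cases hyR : y < R
      · simp only [hg, hyR, if_true]; exact mul_nonneg (sq_nonneg _) (bogoliubovProfile_nonneg hy)
      · simp [hg, hyR]
    have hmaj : IntegrableOn (fun y => (Ioo (0 : ℝ) R).indicator (fun _ => (1 / 2 : ℝ)) y) (Ioi 0) := by
      refine Integrable.integrableOn ?_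
      refine (integrable_indicator_iff measurableSet_Ioo).2 ?_
      exact integrableOn_const (by simp [Real.volume_Ioo])
    calc ∫ y in Ioi (0 : ℝ), y ^ 2 * g y
        ≤ ∫ y in Ioi (0 : ℝ), (Ioo (0 : ℝ) R).indicator (fun _ => (1 / 2 : ℝ)) y :=
          integral_mono_of_nonneg ((ae_restrict_iff' measurableSet_Ioi).2 (ae_of_all _ hnn))
            hmaj ((ae_restrict_iff' measurableSet_Ioi).2 (ae_of_all _ hle))
      _ = R / 2 := by
          rw [setIntegral_indicator measurableSet_Ioo, Set.inter_eq_right.2 Ioo_subset_Ioi_self,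
            setIntegral_const, Real.volume_real_Ioo_of_le hR, smul_eq_mul]
          ring
  have hball : (volume : Measure Space).real (Metric.ball 0 1) = 4 / 3 * π := by
    rw [measureReal_def, EuclideanSpace.volume_ball_fin_three]
    rw [ENNReal.toReal_mul, ← ENNReal.ofReal_pow zero_le_one, one_pow, ENNReal.toReal_ofReal zero_le_one,
      ENNReal.toReal_ofReal (by positivity)]
    ring
  rw [hball]
  calc (3 : ℝ) * (4 / 3 * π * ∫ y in Ioi (0 : ℝ), y ^ 2 * g y) ≤ 3 * (4 / 3 * π * (R / 2)) := by
        gcongr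
    _ = 2 * π * R := by ring

/-- `√3 < 2`. [folklore] -/
theorem sqrt_three_lt_two : Real.sqrt 3 < 2 := by
  rw [show (2 : ℝ) = Real.sqrt 4 by rw [show (4 : ℝ) = 2 ^ 2 by norm_num, Real.sqrt_sq (by norm_num)]]
  exact Real.sqrt_lt_sqrt (by norm_num) (by norm_num)

/-- **The origin cell**: `0 ≤ ∫_{[0,h)³} f(‖q‖)dq ≤ 4πh` (`[0,h)³ ⊂ B(0, 2h)` and the ball
bound). [cite: FournaisEtAl2024, Lemma 8.1 (proof)] -/
theorem abs_setIntegral_originCell_le {h : ℝ} (hh : 0 < h) :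
    |∫ q in {q : Space | ∀ i, 0 ≤ q i ∧ q i < h}, 𝔣 ‖q‖| ≤ 4 * π * h := by
  set S : Set Space := {q : Space | ∀ i, 0 ≤ q i ∧ q i < h} with hS
  have hsub : S ⊆ Metric.ball (0 : Space) (2 * h) := by
    intro q hq
    rw [mem_ball_zero_iff]
    have h1 : ‖q‖ ≤ Real.sqrt 3 * h := norm_le_sqrt_three_mul fun i => ⟨(hq i).1, (hq i).2.le⟩
    have h2 : Real.sqrt 3 * h < 2 * h := mul_lt_mul_of_pos_right sqrt_three_lt_two hh
    linarith
  have hnn : 0 ≤ᵐ[volume.restrict S] fun q : Space => 𝔣 ‖q‖ :=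
    ae_restrict_of_ae bogoliubovProfile_norm_nonneg_ae
  have hnnB : 0 ≤ᵐ[volume.restrict (Metric.ball (0 : Space) (2 * h))] fun q : Space => 𝔣 ‖q‖ :=
    ae_restrict_of_ae bogoliubovProfile_norm_nonneg_ae
  have hlow : 0 ≤ ∫ q in S, 𝔣 ‖q‖ := integral_nonneg_of_ae hnn
  have hup : ∫ q in S, 𝔣 ‖q‖ ≤ ∫ q in Metric.ball (0 : Space) (2 * h), 𝔣 ‖q‖ :=
    setIntegral_mono_set integrable_bogoliubovProfile_norm.integrableOn hnnB
      (Eventually.of_forall hsub)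
  rw [abs_of_nonneg hlow]
  calc ∫ q in S, 𝔣 ‖q‖ ≤ ∫ q in Metric.ball (0 : Space) (2 * h), 𝔣 ‖q‖ := hup
    _ ≤ 2 * π * (2 * h) := setIntegral_ball_bogoliubovProfile_norm_le (by positivity)
    _ = 4 * π * h := by ring

/-! ### E. The Riemann sum versus the integral -/

/-- **The LHY Riemann sum on the Neumann lattice** [FournaisEtAl2024, Lemma 8.1, last display:
"one easily checks"]. For the radial Bogoliubov profile
`f(r) = √(r⁴+2r²) - r² - 1 + 1/(2r²)` (`= r²G(r⁻²)`, the `μ = 1` integrand of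
`integral_bogoliubov`) and a mesh `0 < h ≤ ½`, the Riemann sum over the octant lattice `hℕ₀³ ∖ 0`
approximates the octant integral:
`|h³ ∑_{k ∈ ℕ₀³, k ≠ 0} f(h|k|) - ∫_{ℝ₊³} f(|q|) dq| ≤ 270 h (1 + |log h|)`
(and the lattice sum converges, `summable_lhyRiemannTerm`). Cells `C_k = h(k + [0,1)³)` tile the
octant; on `C_k`, `k ≠ 0`, the mean value theorem with `|f'| ≤ 6r⁻³` (`|k|∞ < ⌈1/h⌉`) or
`|f'| ≤ 3r⁻⁵` (`|k|∞ ≥ ⌈1/h⌉`) and the shell sums of `LHYLatticeSums` give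
`72√3 h(1 + |log h|) + 72√3 h`, the origin cell gives `4πh`. With `h = π/(ℓ√(8πρ_z a))` and
the scaling `p²G(λ/p²) = λ f(|p|/√λ)` this is the passage from the Neumann mode sum
`(π³/ℓ³)∑_{p ∈ Λ*₊} p²G(8πρ_z a/p²)` to `8∫_{ℝ₊³} = ∫_{ℝ³}` (`integral_bogoliubov`,
`lhy_correction_integral`: the constant `128/(15√π)`). [cite: FournaisEtAl2024, Lemma 8.1 (proof)] -/
theorem abs_lhyRiemannSum_sub_integral_le {h : ℝ} (hh : 0 < h) (hh2 : h ≤ 1 / 2) :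
    |h ^ 3 * ∑' k : Fin 3 → ℕ, (if k = 0 then 0 else
          𝔣 (h * ‖(WithLp.toLp 2 (fun i => (k i : ℝ)) : Space)‖)) -
        ∫ q in {q : Space | ∀ i, 0 ≤ q i}, 𝔣 ‖q‖| ≤ 270 * h * (1 + |Real.log h|) ∧
      Summable fun k : Fin 3 → ℕ => (if k = 0 then 0 else
          𝔣 (h * ‖(WithLp.toLp 2 (fun i => (k i : ℝ)) : Space)‖)) := by
  -- notation
  set v : (Fin 3 → ℕ) → Space := fun k => WithLp.toLp 2 (fun i => (k i : ℝ)) with hv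
  set C : (Fin 3 → ℕ) → Set Space := fun k => {q : Space | ∀ i, h * k i ≤ q i ∧ q i < h * (k i + 1)}
    with hC
  set a : (Fin 3 → ℕ) → ℝ := fun k => if k = 0 then 0 else h ^ 3 * 𝔣 (h * ‖v k‖) with ha
  set b : (Fin 3 → ℕ) → ℝ := fun k => ∫ q in C k, 𝔣 ‖q‖ with hb
  set N : ℕ := ⌈h⁻¹⌉₊ with hN
  set e : (Fin 3 → ℕ) → ℝ := fun k =>
    (if k = 0 then 4 * π * h else 0) +
      ((if N ≤ Finset.univ.sup k then 3 * Real.sqrt 3 * h⁻¹ * (((Finset.univ.sup k : ℕ) : ℝ) ^ 5)⁻¹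
        else 0) +
      (if 0 < Finset.univ.sup k ∧ Finset.univ.sup k ≤ N - 1 then
        6 * Real.sqrt 3 * h * (((Finset.univ.sup k : ℕ) : ℝ) ^ 3)⁻¹ else 0)) with he
  -- facts about `N = ⌈1/h⌉`
  have hhinv : 2 ≤ h⁻¹ := by rw [le_inv_comm₀ (by norm_num) hh]; linarith
  have hNge : h⁻¹ ≤ N := Nat.le_ceil _
  have hN2 : 2 ≤ N := by
    have : (2 : ℝ) ≤ N := hhinv.trans hNge
    exact_mod_cast this
  have hN1 : 1 ≤ N := le_trans (by norm_num) hN2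
  have hNpos : (0 : ℝ) < N := by exact_mod_cast (lt_of_lt_of_le (by norm_num) hN1)
  have hNsub : ((N - 1 : ℕ) : ℝ) ≤ h⁻¹ := by
    have h1 : (N : ℝ) < h⁻¹ + 1 := Nat.ceil_lt_add_one (by positivity)
    rw [Nat.cast_sub hN1]; push_cast; linarith
  have hhN : 1 ≤ h * N := by
    rw [← inv_le_iff_one_le_mul₀' hh]; exact hNge
  -- E1: the cell-wise errors
  have he_nonneg : ∀ k, 0 ≤ e k := fun k => by
    simp only [he]
    refine add_nonneg ?_ (add_nonneg ?_ ?_) <;> split_ifs <;> positivity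
  have hab : ∀ k, |a k - b k| ≤ e k := by
    intro k
    by_cases hk : k = 0
    · -- the origin cell
      subst hk
      have hC0 : C 0 = {q : Space | ∀ i, 0 ≤ q i ∧ q i < h} := by
        ext q; simp [hC]
      simp only [ha, hb, if_true, zero_sub, abs_neg, hC0]
      have h0 := abs_setIntegral_originCell_le hh
      have h0e : 4 * π * h ≤ e 0 := by
        have h1 : 0 ≤ (if N ≤ Finset.univ.sup (0 : Fin 3 → ℕ) then
            3 * Real.sqrt 3 * h⁻¹ * (((Finset.univ.sup (0 : Fin 3 → ℕ) : ℕ) : ℝ) ^ 5)⁻¹ else 0) := by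
          split_ifs <;> positivity
        have h2 : 0 ≤ (if 0 < Finset.univ.sup (0 : Fin 3 → ℕ) ∧ Finset.univ.sup (0 : Fin 3 → ℕ) ≤ N - 1
            then 6 * Real.sqrt 3 * h * (((Finset.univ.sup (0 : Fin 3 → ℕ) : ℕ) : ℝ) ^ 3)⁻¹ else 0) := by
          split_ifs <;> positivity
        simp only [he, if_true]
        linarith
      exact h0.trans h0e
    · -- `k ≠ 0`
      have hsup1 : 1 ≤ Finset.univ.sup k := one_le_sup_of_ne_zero hk
      have hsupR : (1 : ℝ) ≤ ((Finset.univ.sup k : ℕ) : ℝ) := by exact_mod_cast hsup1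
      have hsupv : ((Finset.univ.sup k : ℕ) : ℝ) ≤ ‖v k‖ := sup_le_norm_latticePoint k
      have hsv : 0 < h * ((Finset.univ.sup k : ℕ) : ℝ) := by positivity
      simp only [ha, hb, hk, if_false]
      by_cases hfar : N ≤ Finset.univ.sup k
      · -- far cells: `|f'| ≤ 3 r⁻⁵ ≤ 3 (h|k|∞)⁻⁵`
        have hge1 : 1 ≤ h * ((Finset.univ.sup k : ℕ) : ℝ) := by
          refine hhN.trans ?_
          exact mul_le_mul_of_nonneg_left (by exact_mod_cast hfar) hh.le
        set M : ℝ := 3 / (h * ((Finset.univ.sup k : ℕ) : ℝ)) ^ 5 with hM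
        have hMbd : ∀ r, h * ‖v k‖ ≤ r → |𝔣' r| ≤ M := by
          intro r hr
          have hr1 : h * ((Finset.univ.sup k : ℕ) : ℝ) ≤ r :=
            le_trans (mul_le_mul_of_nonneg_left hsupv hh.le) hr
          have hr1' : 1 ≤ r := hge1.trans hr1
          refine (abs_bogoliubovProfile_deriv_le_of_one_le hr1').trans ?_
          rw [hM]
          exact div_le_div_of_nonneg_left (by norm_num) (by positivity)
            (pow_le_pow_left₀ hsv.le hr1 5)
        have hcell := abs_riemannTerm_sub_setIntegral_le hh hk hMbd
        have hX : h ^ 3 * (M * (Real.sqrt 3 * h)) =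
            3 * Real.sqrt 3 * h⁻¹ * (((Finset.univ.sup k : ℕ) : ℝ) ^ 5)⁻¹ := by
          rw [hM]; field_simp
        have hXe : 3 * Real.sqrt 3 * h⁻¹ * (((Finset.univ.sup k : ℕ) : ℝ) ^ 5)⁻¹ ≤ e k := by
          have h1 : 0 ≤ (if k = 0 then 4 * π * h else 0) := by rw [if_neg hk]
          have h2 : 0 ≤ (if 0 < Finset.univ.sup k ∧ Finset.univ.sup k ≤ N - 1
              then 6 * Real.sqrt 3 * h * (((Finset.univ.sup k : ℕ) : ℝ) ^ 3)⁻¹ else 0) := by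
            split_ifs <;> positivity
          simp only [he]
          rw [if_pos hfar]
          linarith
        calc _ ≤ h ^ 3 * (M * (Real.sqrt 3 * h)) := hcell
          _ = _ := hX
          _ ≤ e k := hXe
      · -- near cells: `|f'| ≤ 6 r⁻³ ≤ 6 (h|k|∞)⁻³`
        have hlt : Finset.univ.sup k < N := not_le.1 hfar
        set M : ℝ := 6 / (h * ((Finset.univ.sup k : ℕ) : ℝ)) ^ 3 with hM
        have hMbd : ∀ r, h * ‖v k‖ ≤ r → |𝔣' r| ≤ M := by
          intro r hr
          have hr1 : h * ((Finset.univ.sup k : ℕ) : ℝ) ≤ r :=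
            le_trans (mul_le_mul_of_nonneg_left hsupv hh.le) hr
          have hr0 : 0 < r := hsv.trans_le hr1
          refine (abs_bogoliubovProfile_deriv_le hr0).trans ?_
          rw [hM]
          exact div_le_div_of_nonneg_left (by norm_num) (by positivity)
            (pow_le_pow_left₀ hsv.le hr1 3)
        have hcell := abs_riemannTerm_sub_setIntegral_le hh hk hMbd
        have hX : h ^ 3 * (M * (Real.sqrt 3 * h)) =
            6 * Real.sqrt 3 * h * (((Finset.univ.sup k : ℕ) : ℝ) ^ 3)⁻¹ := by
          rw [hM]; field_simp
        have hXe : 6 * Real.sqrt 3 * h * (((Finset.univ.sup k : ℕ) : ℝ) ^ 3)⁻¹ ≤ e k := by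
          have h1 : 0 ≤ (if k = 0 then 4 * π * h else 0) := by rw [if_neg hk]
          have h2 : 0 ≤ (if N ≤ Finset.univ.sup k then
              3 * Real.sqrt 3 * h⁻¹ * (((Finset.univ.sup k : ℕ) : ℝ) ^ 5)⁻¹ else 0) := by
            rw [if_neg hfar]
          have hcond : 0 < Finset.univ.sup k ∧ Finset.univ.sup k ≤ N - 1 := ⟨hsup1, by omega⟩
          simp only [he]
          rw [if_pos hcond]
          linarith
        calc _ ≤ h ^ 3 * (M * (Real.sqrt 3 * h)) := hcell
          _ = _ := hX
          _ ≤ e k := hXe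
  -- E2: partial sums of `e`
  have hsqrt3 : Real.sqrt 3 < 1.7321 := by
    rw [show (1.7321 : ℝ) = Real.sqrt (1.7321 ^ 2) by rw [Real.sqrt_sq (by norm_num)]]
    exact Real.sqrt_lt_sqrt (by norm_num) (by norm_num)
  have hsqrt3pos : 0 < Real.sqrt 3 := Real.sqrt_pos.2 (by norm_num)
  have hlogN : Real.log ((N - 1 : ℕ) : ℝ) ≤ |Real.log h| := by
    have hlog_inv : Real.log h⁻¹ = -Real.log h := Real.log_inv h
    have habs : -Real.log h ≤ |Real.log h| := neg_le_abs _
    rcases Nat.eq_zero_or_pos (N - 1) with h0 | hpos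
    · rw [h0]; simp
    · have hpos' : (0 : ℝ) < ((N - 1 : ℕ) : ℝ) := by exact_mod_cast hpos
      calc Real.log ((N - 1 : ℕ) : ℝ) ≤ Real.log h⁻¹ := Real.log_le_log hpos' hNsub
        _ ≤ |Real.log h| := by rw [hlog_inv]; exact habs
  have hpartial : ∀ u : Finset (Fin 3 → ℕ), ∑ k ∈ u, e k ≤ 270 * h * (1 + |Real.log h|) := by
    intro u
    have hsplit : ∑ k ∈ u, e k = (∑ k ∈ u, if k = 0 then 4 * π * h else 0) +
        ((∑ k ∈ u, if N ≤ Finset.univ.sup k then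
            3 * Real.sqrt 3 * h⁻¹ * (((Finset.univ.sup k : ℕ) : ℝ) ^ 5)⁻¹ else 0) +
        (∑ k ∈ u, if 0 < Finset.univ.sup k ∧ Finset.univ.sup k ≤ N - 1 then
            6 * Real.sqrt 3 * h * (((Finset.univ.sup k : ℕ) : ℝ) ^ 3)⁻¹ else 0)) := by
      simp only [he, Finset.sum_add_distrib]
    -- the three pieces
    have h0 : (∑ k ∈ u, if k = 0 then 4 * π * h else 0) ≤ 4 * π * h := by
      rw [Finset.sum_ite_eq' u (0 : Fin 3 → ℕ) (fun _ => 4 * π * h)]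
      split_ifs
      · exact le_rfl
      · positivity
    have h1 : (∑ k ∈ u, if N ≤ Finset.univ.sup k then
        3 * Real.sqrt 3 * h⁻¹ * (((Finset.univ.sup k : ℕ) : ℝ) ^ 5)⁻¹ else 0) ≤ 72 * Real.sqrt 3 * h := by
      rw [← Finset.sum_filter, ← Finset.mul_sum]
      have hB := sum_inv_sup_pow_five_le hN1 u
      have hN2' : 24 / (N : ℝ) ^ 2 ≤ 24 * h ^ 2 := by
        rw [div_le_iff₀ (by positivity)]
        have : 1 ≤ (h * N) ^ 2 := one_le_pow₀ hhN
        nlinarith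
      calc 3 * Real.sqrt 3 * h⁻¹ * ∑ k ∈ u.filter (fun k => N ≤ Finset.univ.sup k),
              (((Finset.univ.sup k : ℕ) : ℝ) ^ 5)⁻¹
          ≤ 3 * Real.sqrt 3 * h⁻¹ * (24 * h ^ 2) := by
            exact mul_le_mul_of_nonneg_left (hB.trans hN2') (by positivity)
        _ = 72 * Real.sqrt 3 * h := by field_simp; ring
    have h2 : (∑ k ∈ u, if 0 < Finset.univ.sup k ∧ Finset.univ.sup k ≤ N - 1 then
        6 * Real.sqrt 3 * h * (((Finset.univ.sup k : ℕ) : ℝ) ^ 3)⁻¹ else 0) ≤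
        72 * Real.sqrt 3 * h * (1 + |Real.log h|) := by
      rw [← Finset.sum_filter, ← Finset.mul_sum]
      have hA := sum_inv_sup_pow_three_le (N - 1) u
      calc 6 * Real.sqrt 3 * h * ∑ k ∈ u.filter (fun k => 0 < Finset.univ.sup k ∧ Finset.univ.sup k ≤ N - 1),
              (((Finset.univ.sup k : ℕ) : ℝ) ^ 3)⁻¹
          ≤ 6 * Real.sqrt 3 * h * (12 * (1 + |Real.log h|)) := by
            refine mul_le_mul_of_nonneg_left (hA.trans ?_) (by positivity)
            gcongr
        _ = 72 * Real.sqrt 3 * h * (1 + |Real.log h|) := by ring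
    rw [hsplit]
    have hL : 0 ≤ |Real.log h| := abs_nonneg _
    nlinarith [h0, h1, h2, Real.pi_lt_d2, Real.pi_pos, hsqrt3, hsqrt3pos, hh, hL,
      mul_nonneg hh.le hL]
  -- E3: summability
  have he_sum : Summable e := summable_of_sum_le he_nonneg hpartial
  have htsum_e : ∑' k, e k ≤ 270 * h * (1 + |Real.log h|) := Real.tsum_le_of_sum_le he_nonneg hpartial
  have hbsum : HasSum b (∫ q in {q : Space | ∀ i, 0 ≤ q i}, 𝔣 ‖q‖) := by
    rw [← iUnion_latticeCell hh]
    exact hasSum_integral_iUnion (measurableSet_latticeCell h) (pairwise_disjoint_latticeCell hh)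
      integrable_bogoliubovProfile_norm.integrableOn
  have hab_sum : Summable fun k => a k - b k :=
    Summable.of_norm_bounded he_sum fun k => by rw [Real.norm_eq_abs]; exact hab k
  have ha_sum : Summable a := by
    have := hab_sum.add hbsum.summable
    refine this.congr fun k => ?_
    ring
  -- E4: the tsum of `a` is `h³` times the lattice sum
  have ha_eq : ∑' k, a k = h ^ 3 * ∑' k : Fin 3 → ℕ, (if k = 0 then 0 else 𝔣 (h * ‖v k‖)) := by
    rw [← tsum_mul_left]
    refine tsum_congr fun k => ?_
    simp only [ha]
    split_ifs <;> simp
  have hsummable : Summable fun k : Fin 3 → ℕ => (if k = 0 then 0 else 𝔣 (h * ‖v k‖)) := by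
    have h3 : h ^ 3 ≠ 0 := by positivity
    have := ha_sum.mul_left (h ^ 3)⁻¹
    refine this.congr fun k => ?_
    simp only [ha]
    split_ifs
    · simp
    · field_simp
  refine ⟨?_, hsummable⟩
  -- E5: conclusion
  rw [← ha_eq, ← hbsum.tsum_eq, ← (ha_sum.tsum_sub hbsum.summable)]
  have hnorm_sum : Summable fun k => ‖a k - b k‖ :=
    Summable.of_nonneg_of_le (fun k => norm_nonneg _)
      (fun k => by rw [Real.norm_eq_abs]; exact hab k) he_sum
  calc |∑' k, (a k - b k)| = ‖∑' k, (a k - b k)‖ := (Real.norm_eq_abs _).symm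
    _ ≤ ∑' k, ‖a k - b k‖ := norm_tsum_le_tsum_norm hnorm_sum
    _ ≤ ∑' k, e k := Summable.tsum_le_tsum (fun k => by rw [Real.norm_eq_abs]; exact hab k)
        hnorm_sum he_sum
    _ ≤ 270 * h * (1 + |Real.log h|) := htsum_e

/-! ### The scaled form: general `λ = 8πρ_z a` -/

/-- The scaling of the Bogoliubov integrand: `√(r⁴+2λr²) - r² - λ + λ²/(2r²) = λ f(r/√λ)`
(`λ > 0`; also at `r = 0` with Lean's conventions). [cite: FournaisEtAl2024, Lemma 8.1 (proof)] -/
theorem bogoliubovIntegrand_eq_mul_profile {lam : ℝ} (hlam : 0 < lam) (r : ℝ) :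
    Real.sqrt (r ^ 4 + 2 * lam * r ^ 2) - r ^ 2 - lam + lam ^ 2 / (2 * r ^ 2) =
      lam * 𝔣 (r / Real.sqrt lam) := by
  set s := Real.sqrt lam with hs
  have hs0 : 0 < s := Real.sqrt_pos.2 hlam
  have hs2 : s ^ 2 = lam := Real.sq_sqrt hlam.le
  have hroot : Real.sqrt ((r / s) ^ 4 + 2 * (r / s) ^ 2) = Real.sqrt (r ^ 4 + 2 * lam * r ^ 2) / s ^ 2 := by
    have h1 : (r / s) ^ 4 + 2 * (r / s) ^ 2 = (r ^ 4 + 2 * lam * r ^ 2) / (s ^ 2) ^ 2 := by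
      rw [← hs2]; field_simp
    rw [h1, Real.sqrt_div' _ (by positivity), Real.sqrt_sq (by positivity)]
  simp only []
  rw [hroot, ← hs2]
  rcases eq_or_ne r 0 with hr | hr
  · subst hr; simp
  · field_simp

/-- The positive octant is invariant under positive dilations. [folklore] -/
theorem smul_octant_eq {R : ℝ} (hR : 0 < R) :
    R • {q : Space | ∀ i, 0 ≤ q i} = {q : Space | ∀ i, 0 ≤ q i} := by
  ext q
  rw [Set.mem_smul_set_iff_inv_smul_mem₀ hR.ne']
  simp only [Set.mem_setOf_eq, PiLp.smul_apply, smul_eq_mul]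
  refine forall_congr' fun i => ?_
  constructor
  · intro h; nlinarith [mul_nonneg hR.le h, mul_inv_cancel₀ hR.ne']
  · intro h; positivity

/-- **The LHY Riemann sum, scaled form** [FournaisEtAl2024, Lemma 8.1, last display]: for
`λ > 0` (the paper's `8πρ_z a`) and a mesh `0 < h ≤ √λ/2` (the paper's `π/ℓ`),
`|h³ ∑_{k ∈ ℕ₀³∖0} F_λ(h|k|) - ∫_{ℝ₊³} F_λ(|q|)dq| ≤ 270 λ² h (1 + |log(h/√λ)|)`,
`F_λ(p) = √(p⁴+2λp²) - p² - λ + λ²/(2p²) = p²G(λ/p²) + …` — the integrand of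
`integral_bogoliubov` (whose value over `ℝ³ = 8·ℝ₊³` is `(32√2π/15)λ^{5/2}`, giving `128/(15√π)`
in `lhy_correction_integral`). From `abs_lhyRiemannSum_sub_integral_le` by the scaling `q = √λ q'`.
[cite: FournaisEtAl2024, Lemma 8.1 (proof)] -/
theorem abs_lhyRiemannSum_sub_integral_le_scaled {lam h : ℝ} (hlam : 0 < lam) (hh : 0 < h)
    (hsmall : h ≤ Real.sqrt lam / 2) :
    |h ^ 3 * ∑' k : Fin 3 → ℕ, (if k = 0 then 0 else
          (Real.sqrt ((h * ‖(WithLp.toLp 2 (fun i => (k i : ℝ)) : Space)‖) ^ 4 +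
                2 * lam * (h * ‖(WithLp.toLp 2 (fun i => (k i : ℝ)) : Space)‖) ^ 2) -
              (h * ‖(WithLp.toLp 2 (fun i => (k i : ℝ)) : Space)‖) ^ 2 - lam +
            lam ^ 2 / (2 * (h * ‖(WithLp.toLp 2 (fun i => (k i : ℝ)) : Space)‖) ^ 2))) -
        ∫ q in {q : Space | ∀ i, 0 ≤ q i},
          (Real.sqrt (‖q‖ ^ 4 + 2 * lam * ‖q‖ ^ 2) - ‖q‖ ^ 2 - lam + lam ^ 2 / (2 * ‖q‖ ^ 2))| ≤
      270 * lam ^ 2 * h * (1 + |Real.log (h / Real.sqrt lam)|) := by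
  set s := Real.sqrt lam with hs
  have hs0 : 0 < s := Real.sqrt_pos.2 hlam
  have hs2 : s ^ 2 = lam := Real.sq_sqrt hlam.le
  set h' := h / s with hh'
  have hh'0 : 0 < h' := div_pos hh hs0
  have hh'2 : h' ≤ 1 / 2 := by rw [hh', div_le_iff₀ hs0]; linarith
  obtain ⟨hmain, _⟩ := abs_lhyRiemannSum_sub_integral_le hh'0 hh'2
  -- the sum
  have hsum : (∑' k : Fin 3 → ℕ, (if k = 0 then 0 else
      (Real.sqrt ((h * ‖(WithLp.toLp 2 (fun i => (k i : ℝ)) : Space)‖) ^ 4 +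
            2 * lam * (h * ‖(WithLp.toLp 2 (fun i => (k i : ℝ)) : Space)‖) ^ 2) -
          (h * ‖(WithLp.toLp 2 (fun i => (k i : ℝ)) : Space)‖) ^ 2 - lam +
        lam ^ 2 / (2 * (h * ‖(WithLp.toLp 2 (fun i => (k i : ℝ)) : Space)‖) ^ 2)))) =
      lam * ∑' k : Fin 3 → ℕ, (if k = 0 then 0 else
        𝔣 (h' * ‖(WithLp.toLp 2 (fun i => (k i : ℝ)) : Space)‖)) := by
    rw [← tsum_mul_left]
    refine tsum_congr fun k => ?_
    split_ifs with hk
    · simp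
    · rw [bogoliubovIntegrand_eq_mul_profile hlam]
      congr 2
      rw [hh']; ring
  -- the integral
  have hint : ∫ q in {q : Space | ∀ i, 0 ≤ q i},
      (Real.sqrt (‖q‖ ^ 4 + 2 * lam * ‖q‖ ^ 2) - ‖q‖ ^ 2 - lam + lam ^ 2 / (2 * ‖q‖ ^ 2)) =
      lam * (s ^ 3 * ∫ q in {q : Space | ∀ i, 0 ≤ q i}, 𝔣 ‖q‖) := by
    have h1 : ∀ q : Space, Real.sqrt (‖q‖ ^ 4 + 2 * lam * ‖q‖ ^ 2) - ‖q‖ ^ 2 - lam +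
        lam ^ 2 / (2 * ‖q‖ ^ 2) = lam * 𝔣 ‖s⁻¹ • q‖ := by
      intro q
      rw [bogoliubovIntegrand_eq_mul_profile hlam, norm_smul, Real.norm_eq_abs,
        abs_of_pos (inv_pos.2 hs0), div_eq_inv_mul]
    simp_rw [h1]
    rw [integral_const_mul, Measure.setIntegral_comp_smul_of_pos volume
      (fun q : Space => 𝔣 ‖q‖) {q : Space | ∀ i, 0 ≤ q i} (inv_pos.2 hs0),
      smul_octant_eq (inv_pos.2 hs0), finrank_euclideanSpace_fin, smul_eq_mul, inv_pow, inv_inv]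
  rw [hsum, hint]
  have hh3 : h ^ 3 = s ^ 3 * h' ^ 3 := by rw [hh']; field_simp
  rw [hh3]
  have hfac : s ^ 3 * h' ^ 3 * (lam * ∑' k : Fin 3 → ℕ, (if k = 0 then 0 else
        𝔣 (h' * ‖(WithLp.toLp 2 (fun i => (k i : ℝ)) : Space)‖))) -
      lam * (s ^ 3 * ∫ q in {q : Space | ∀ i, 0 ≤ q i}, 𝔣 ‖q‖) =
      lam * s ^ 3 * (h' ^ 3 * ∑' k : Fin 3 → ℕ, (if k = 0 then 0 else
        𝔣 (h' * ‖(WithLp.toLp 2 (fun i => (k i : ℝ)) : Space)‖)) -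
        ∫ q in {q : Space | ∀ i, 0 ≤ q i}, 𝔣 ‖q‖) := by ring
  rw [hfac, abs_mul, abs_of_pos (by positivity : 0 < lam * s ^ 3)]
  calc lam * s ^ 3 * |h' ^ 3 * ∑' k : Fin 3 → ℕ, (if k = 0 then 0 else
          𝔣 (h' * ‖(WithLp.toLp 2 (fun i => (k i : ℝ)) : Space)‖)) -
          ∫ q in {q : Space | ∀ i, 0 ≤ q i}, 𝔣 ‖q‖|
      ≤ lam * s ^ 3 * (270 * h' * (1 + |Real.log h'|)) :=
        mul_le_mul_of_nonneg_left hmain (by positivity)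
    _ = 270 * lam ^ 2 * h * (1 + |Real.log h'|) := by
        rw [hh']
        field_simp
        rw [← hs2]
    _ = 270 * lam ^ 2 * h * (1 + |Real.log (h / Real.sqrt lam)|) := by rw [hh', hs]

end Literature.MathematicalPhysics.QuantumManyBody.BoseGas

end
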